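import Mathlib
import Summits.Ventures.LatticeQCDFlow.TrivializingMaps.WilsonMeasureTrivializingMap
import HarnessLib

/-!
# The strong-coupling trivializing map is a gauge-equivariant homeomorphism of `SU(n)^E`

HONEST FRAMING: exact (Metropolis-corrected) sampling algorithms for lattice gauge theory; figures
of merit are autocorrelation/cost numbers at stated couplings and volumes; no continuum-physics claim.
Finite periodic lattices `(ℤ/L)^d`; the window `β₀(d,n,B)` does not depend on `L`.

M. Lüscher, CMP 293 (2010) 899–919 [Luscher2010Trivializing], §3.2: "the transformation is invertible …
because the flow equation can be integrated backwards from `t` to `0`".  The cited `TrivializingMapExists`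
(file A) asks for a trivializing BIJECTION of the field manifold (indeed a diffeomorphism, by Moser).  For
the Wilson action in the strong-coupling window, `StrongCouplingTrivializingMap.lean` produced the time-one
map `Φ_1` of Lüscher's flow as a continuous gauge-equivariant trivializing map; with the tree's backward
integration (`exists_continuous_inverse_flowMap_one`, §3.2 PROVED) it is upgraded here to a HOMEOMORPHISM:

* `exists_trivializingHomeomorph_smul_ambWilsonAction` — for every `d`, `n ≠ 0`, basis `B`, every `L` and
  `|β| < β₀(d,n,B)`: a gauge-equivariant homeomorphism `Φ : SU(n)^E ≃ₜ SU(n)^E` with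
  `Φ_* D[V] = 𝒵⁻¹ e^{-β S_W} D[U]` (`IsTrivializingMap`), `= wilsonMeasure ρ₀ β`.

(The smoothness clauses of `TrivializingMapExists` — `Φ`, `Φ⁻¹` restrictions of smooth ambient maps — are NOT
claimed: differentiable dependence of flows on initial data is not in the tree.)
Authored by the pub-lqcd lean-2 seat (cell lqcd-flow, FANOUT row 31 GEN-4). Tags: [ours].
-/

noncomputable section

namespace Summit.Ventures.LatticeQCDFlow.TrivializingMaps

open MeasureTheory
open scoped Matrix Matrix.Norms.Frobenius ContDiff
open Literature.MathematicalPhysics.QuantumFieldTheory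
open Literature.MathematicalPhysics.QuantumFieldTheory.Luscher2010
open Summit.Ventures.LatticeQCDFlow.Exactness (IsGaugeEquivariant)
open AnalyticSeries

namespace StrongCoupling

variable {d L n : ℕ} [NeZero L]

/-- **The strong-coupling trivializing map is a gauge-equivariant homeomorphism (ours; PROVED).**  For every
`d`, `n ≠ 0`, orthonormal basis `B` of `𝔰𝔲(n)`, every lattice size `L` and every `|β| < β₀(d,n,B)` there is
a homeomorphism `Φ` of `SU(n)^E` — the time-one map of the flow of `Z_t = -∂S̃_t`, inverted by integrating
the flow backwards (§3.2) — which is gauge equivariant and trivializing for `β·S_W`: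
`Φ_* D[V] = 𝒵⁻¹ e^{-β S_W} D[U] = wilsonMeasure ρ₀ β`. [ours; cite: Luscher2010Trivializing, §3.2, §4.2] -/
theorem exists_trivializingHomeomorph_smul_ambWilsonAction (hn : n ≠ 0) (B : SuBasis n) {β : ℝ}
    (hβ : |β| < beta0 d n B) :
    ∃ Φ : GaugeConfig d L (Matrix.specialUnitaryGroup (Fin n) ℂ) ≃ₜ
        GaugeConfig d L (Matrix.specialUnitaryGroup (Fin n) ℂ),
      IsGaugeEquivariant Φ ∧
      IsTrivializingMap
        (fun U : GaugeConfig d L (Matrix.specialUnitaryGroup (Fin n) ℂ) =>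
          β * ambWilsonAction (WilsonFlow.coeConfig U)) Φ ∧
      Measure.map Φ (Measure.pi fun _ : Edge d L => haarProbability (Matrix.specialUnitaryGroup (Fin n) ℂ)) =
        wilsonMeasure (d := d) (L := L) (defRep n) β := by
  obtain ⟨Φ, hΦ, hcont, hgauge, htriv⟩ :=
    exists_trivializingFlow_smul_ambWilsonAction (d := d) (L := L) hn B hβ
  have hF : ContDiff ℝ ∞ fun p : ℝ × AmbConfig d L n => flowActionG (d := d) (L := L) B β p.1 p.2 :=
    contDiff_flowActionG hn B (window_analytic hβ)
  obtain ⟨Ψ, hΨc, hleft, hright⟩ :=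
    exists_continuous_inverse_flowMap_one flowGlobalExistence_holds B hF hΦ
  have hΦ1c : Continuous (Φ 1) := hcont.comp (continuous_const.prodMk continuous_id)
  let H : GaugeConfig d L (Matrix.specialUnitaryGroup (Fin n) ℂ) ≃ₜ
      GaugeConfig d L (Matrix.specialUnitaryGroup (Fin n) ℂ) :=
    { toFun := Φ 1
      invFun := Ψ
      left_inv := hleft
      right_inv := hright
      continuous_toFun := hΦ1c
      continuous_invFun := hΨc }
  refine ⟨H, hgauge 1, htriv, ?_⟩
  rw [← boltzmannMeasure_smul_ambWilsonAction β]
  exact htriv.2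

end StrongCoupling

end Summit.Ventures.LatticeQCDFlow.TrivializingMaps

end
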